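import Summits.ABC.IUTFork.Joshi.ArithmeticoidProperties
import Summits.ABC.IUTFork.Joshi.ArithmeticoidCohomology

/-!
# [J-II½] §5.2 / §5.5 / §6.2 — junction between the two typings of Joshi's arithmeticoids (slot T-37's `ATS2h.DeformationDatum`
# and slot T-38's parameter carriers): merge-debt T-37 ↔ T-38 PAID in kernel (proof-only; no new claim)

Proof-only reconciliation file of the abc-iut cell, branch E (rung LADDER-ABC:A2.E; seat abc-iut-E-t38). SOURCE: K. Joshi,
*Construction of Arithmetic Teichmüller Spaces II½: Deformations of Number Fields*, arXiv:2305.10398v12 (UNREFEREED; bib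
`Joshi2023ATS2half`); locators «p.N l.M» = line M of page file `pNNNN.txt` of `HOME/plan/repair/lit/renders/Joshi-arxiv-2305.10398-ATS2half/`.
**No side is taken** on [IUTchIII] Cor. 3.12, on Joshi's claims, or on Mochizuki's report on them; typed ≠ proved.

WHAT IS PROVED. Slot T-37 (`Joshi/Arithmeticoids.lean`, `Joshi/ArithmeticoidProperties.lean`) bundles the §4–§5 objects in
`ATS2h.DeformationDatum L V Lv Y K G A` (arithmeticoids `D.Arith = 𝒴_L = ∀ v, Y v`, arithmetic rings `D.arithRing y`, Def. 5.2.1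
`D.TopEquivalent`, Thm. 5.5.2 (7) `D.Thm552_7` with its printed ground `D.LocalTopInequivalent`); slot T-38
(`Joshi/ArithmeticoidCohomology.lean`) states §6.2 over parameter carriers (`ATS2half.TopEquivalent Pt K`, `LocTopIso`,
`KedlayaTemkinChoice`, `Thm621`, `thm621_construction`). Over the datum `D` (instantiate `Pt := Y`, `K := K`,
`IsArc := D.Varc`):
1. the two typings of Def. 5.2.1 AGREE definitionally (`topEquivalent_iff`, by `Iff.rfl`);
2. T-38's Kedlaya–Temkin input (the ∀∃ form the proof of Thm. 6.2.1 uses, p.45 l.11–18) implies T-37's (the ∃∃ form the proof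
   of Thm. 5.5.2 (7) uses, p.35 l.21–27) — `localTopInequivalent_of_kedlayaTemkinChoice` (the point `y⁰_v = D.pt0 v` of
   Thm. 5.5.2 (6) supplies the first point);
3. the printed CONSTRUCTION of Thm. 5.5.2 (7) (p.35 l.28–31 «Choose a v ∈ V^non_L and y₁, y₂ ∈ 𝒴_L such that y_{1,v} = y_{1,v},
   y_{2,v} = y_{2,v}») is T-38's `thm621_construction` with `S = {v}` — `exists_pair_locTopInequivalent_at`;
4. Thm. 5.5.2 (7) AS TYPED by T-37 follows from Thm. 6.2.1 (1) AS TYPED by T-38, at any non-archimedean place —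
   `thm552_7_of_thm621` (print: Rmk. 5.8.3 p.36 l.27–30 «Thanks to the last assertion of Theorem 6.2.1 … arithmeticoids … may
   even be topologically distinguished from each other»).
Nothing here derives either «by construction» step of print (¬ topologically equivalent from one non-homeomorphic factor) —
those stay inside the claims `D.Thm552_7` / `ATS2half.Thm621`. Standard axioms only; sorry-free.
[claim: Joshi2023ATS2half, status: disputed]
-/

set_option autoImplicit false

noncomputable section

namespace Summit.ABC.IUTFork.Joshi.ATS2half

open Summit.ABC.IUTFork.Joshi.ATS2h

variable {L : Type} [Field L] {V : Type} {Lv : V → Type} [∀ v, Field (Lv v)] {Y : V → Type}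
  [∀ v, TopologicalSpace (Y v)] {K : (v : V) → Y v → Type} [∀ v y, Field (K v y)] [∀ v y, TopologicalSpace (K v y)]
  {G : V → Type} [∀ v, Group (G v)] {A : V → Type} [∀ v, Group (A v)]
  (D : DeformationDatum L V Lv Y K G A)

/-- **Def. 5.2.1, the two typings agree** (p.31 l.44–45): T-37's `D.TopEquivalent` and T-38's `ATS2half.TopEquivalent Y K`
are the same proposition on `D.Arith = ∀ v, Y v` (both: a ring isomorphism of `∏_v K_{y_v}` that is a homeomorphism).
[claim: Joshi2023ATS2half, status: disputed] -/
theorem topEquivalent_iff (y₁ y₂ : D.Arith) : D.TopEquivalent y₁ y₂ ↔ TopEquivalent Y K y₁ y₂ :=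
  Iff.rfl

/-- **The Kedlaya–Temkin input, ∀∃ ⟹ ∃∃**: T-38's `KedlayaTemkinChoice` (for EVERY point a second point with non-homeomorphic
residue field — the form the proof of Thm. 6.2.1 chooses with, p.45 l.11–18) implies T-37's `D.LocalTopInequivalent` (SOME
pair — the form the proof of Thm. 5.5.2 (7) cites, p.35 l.21–27), the first point being `y⁰_v = D.pt0 v` of Thm. 5.5.2 (6).
[claim: Joshi2023ATS2half, status: disputed] -/
theorem localTopInequivalent_of_kedlayaTemkinChoice (h : KedlayaTemkinChoice Y K D.Varc) : D.LocalTopInequivalent :=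
  fun v hv => ⟨D.pt0 v, (h v hv (D.pt0 v)).choose, (h v hv (D.pt0 v)).choose_spec⟩

/-- **The construction of Thm. 5.5.2 (7)** (p.35 l.28–31: «Choose a v ∈ V^non_L and y₁, y₂ ∈ 𝒴_L such that y_{1,v} = y_{1,v},
y_{2,v} = y_{2,v}») as an instance of T-38's `thm621_construction` with `S = {v}`: two arithmeticoids of `L` that agree off
`v` and have non-homeomorphic residue fields at `v`. [claim: Joshi2023ATS2half, status: disputed] -/
theorem exists_pair_locTopInequivalent_at (h : KedlayaTemkinChoice Y K D.Varc) {v : V} (hv : v ∉ D.Varc) :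
    ∃ y₁ y₂ : D.Arith, ¬ LocTopIso Y K v (y₁ v) (y₂ v) ∧ y₁ v ≠ y₂ v ∧ ∀ w, w ≠ v → y₂ w = y₁ w := by
  obtain ⟨y₂, hS, hoff⟩ := thm621_construction Y K h {v} (by simpa using hv) (fun w => D.pt0 w)
  exact ⟨fun w => D.pt0 w, y₂, (hS v rfl).1, (hS v rfl).2, fun w hw => hoff w hw⟩

/-- **Thm. 5.5.2 (7) as typed by T-37 from Thm. 6.2.1 (1) as typed by T-38** (Rmk. 5.8.3 p.36 l.27–30 «Thanks to the last
assertion of Theorem 6.2.1 one can say that arithmeticoids of L provide isomorphs of a number field … which may even be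
topologically distinguished from each other»): given one non-archimedean place, `Thm621` yields two arithmeticoids that are
not topologically equivalent. [claim: Joshi2023ATS2half, status: disputed] -/
theorem thm552_7_of_thm621 (h621 : Thm621 Y K D.Varc) {v : V} (hv : v ∉ D.Varc) : D.Thm552_7 := by
  obtain ⟨y₂, hne, -⟩ := h621 {v} ⟨v, rfl⟩ (by simpa using hv) (fun w => D.pt0 w)
  exact ⟨fun w => D.pt0 w, y₂, (topEquivalent_iff D _ _).not.2 hne⟩

end Summit.ABC.IUTFork.Joshi.ATS2half

end
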